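import Summits.Ventures.LatticeQCDFlow.Scoring.TorusFreeEnergyDensity2D
import Summits.Ventures.LatticeQCDFlow.Scoring.OnePlaquetteSU3HaarMoments
import Summits.Ventures.LatticeQCDFlow.Scoring.SU3TraceNormSqHaar
import HarnessLib

/-!
# SU(3) on the Haar measure, UNCONDITIONALLY: Weyl's integral formula for `SU(3)` is now a theorem of the tree

HONEST FRAMING: exact (Metropolis-corrected) sampling algorithms for lattice gauge theory;
figures of merit are autocorrelation/cost numbers at stated couplings and volumes; no
continuum-physics claim.

Venture `LatticeQCDFlow` (cell pub-lqcd), sub-topic `Scoring`; FANOUT row 5 (`s0-sun-a`), GEN-17.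
NEW WORK of the cell (placement rule).

GEN-16 tied row 5's Weyl-torus `SU(3)` one-plaquette law to theory-2's Haar-measure lattice model
(`OnePlaquetteSU3HaarBridge`, `OnePlaquetteSU3HaarMoments`, `SU3TraceNormSqHaar`,
`TorusFreeEnergyDensity2D`) CONDITIONALLY on the tree's named fact
`hW : Literature.RepresentationTheory.CompactGroups.weylIntegralFormula_specialUnitary (Fin 3)` —
Weyl's integral formula for `SU(3)` in pushforward form (Bröcker–tom Dieck, GTM 98, IV (1.11)).
Since 2026-08-23 that fact is PROVED in the tree for every `n`
(`Literature.RepresentationTheory.CompactGroups.weylIntegralFormula_specialUnitary_holds`, files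
`Literature/RepresentationTheory/CompactGroups/WeylIntegration*.lean` of the `lit-balaban` programme:
Helgason's Lie-algebra integration formula in the exponential chart of `U(n)`, then the special part
`u ↦ e^{−i arg det u / n} u` for `SU(n)`).  This file supplies `hW := weylIntegralFormula_specialUnitary_holds (Fin 3)`
to every conditional theorem of those four files, so that the following are now UNCONDITIONAL theorems
about the Haar probability measure of `SU(3)`:

* §1 class functions / trace functions integrate over the two eigen-angles against `|Δ|²/(6(2π)²)`;
* §2 theory-2's one-plaquette integral `z₁^{SU(3)}(β) = e^{−3β} Σ_{q∈ℤ} det[I_{|q+i−j|}(β)]_{i,j<3}`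
  `= e^{−3β} Z₃(3β)/(6(2π)²)`, as an `ℝ≥0∞` and as a real number;
* §3 the Haar one-plaquette expectation of any continuous `f(Re tr U)` is GEN-6's `onePlaquetteExpectSU3 (3β)`;
  the PLAQUETTE `⟨(1/3) Re tr U_p⟩_β` is the Bessel–Toeplitz ratio, is non-decreasing in `β`, and at the
  S0-C point (theory-2 coupling `5/3`, table `β = 5`) lies in `[0.353954436705, 0.353954436706]`; its second
  moment is `onePlaquetteExpectSU3 (3β) plaq²` and the VARIANCE at `5/3` lies in `[0.071934473027, 0.071934473030]`;
* §4 Haar moments: `∫ 1 = 1`, `∫ Re tr U = 0`, `∫ (Re tr U)² = 1/2`, `∫ (Re tr U)³ = 1/4`,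
  `∫ (1 + Re tr U)^k = su3Moment k / 6`, and `∫_{SU(3)} |tr U|² dU = 1` (the fundamental character has norm one);
* §5 the 2-d `SU(3)` torus free energy: `(L²−1)F(β) − 6β ≤ log Z^{SU(3)}_{(ℤ/L)²}(β) ≤ (L²−1)F(β)` and the
  density `log Z_{(ℤ/(L+2))²}(β)/(L+2)² → F(β) = −3β + log Σ_q det[I_{|q+i−j|}(β)]` (`β ≥ 0`).

Every proof is the GEN-16 theorem applied to `weylIntegralFormula_specialUnitary_holds (Fin 3)`; the
statements are restated verbatim without the hypothesis (namespace `…Scoring.SU3Haar`).  No `def`,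
nothing cited as a fact, 0 sorry.
-/

noncomputable section

open Real MeasureTheory Filter Topology Finset
open Literature.MathematicalPhysics.QuantumFieldTheory
open Literature.MathematicalPhysics.QuantumLattice
open Literature.Analysis.FunctionSpaces (besselI)
open Literature.RepresentationTheory.CompactGroups
open Summit.Ventures.LatticeQCDFlow.Theory2.Lattice
open Summit.Ventures.LatticeQCDFlow.Theory2.Lattice.TwoDim

namespace Summit.Ventures.LatticeQCDFlow.Scoring.SU3Haar

/-- Weyl's integral formula for `SU(3)` (pushforward form), the hypothesis `hW` of GEN-16, is a theorem. -/
theorem weyl_su3 : weylIntegralFormula_specialUnitary (Fin 3) :=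
  weylIntegralFormula_specialUnitary_holds (Fin 3)

/-! ### 1. Class functions of `SU(3)` integrate over the eigen-angles -/

/-- **Class functions on `SU(3)` integrate over the eigen-angles against the Weyl density** (unconditional):
for a continuous `F` on matrices invariant under `SU(3)`-conjugation,
`∫_{SU(3)} F(U) dU = (1/(6(2π)²)) ∫_0^{2π}∫_0^{2π} F(diag(e^{iθ₁}, e^{iθ₂}, e^{−i(θ₁+θ₂)})) |Δ|²(θ₁,θ₂) dθ₂ dθ₁`. -/
theorem integral_haar_su3_classFun_eq_integral2
    (F : Matrix (Fin 3) (Fin 3) ℂ → ℝ) (hF : Continuous F)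
    (hcl : ∀ g U : Matrix.specialUnitaryGroup (Fin 3) ℂ,
      F (((g * U * g⁻¹ : Matrix.specialUnitaryGroup (Fin 3) ℂ)) : Matrix (Fin 3) (Fin 3) ℂ)
        = F ((U : Matrix.specialUnitaryGroup (Fin 3) ℂ) : Matrix (Fin 3) (Fin 3) ℂ)) :
    ∫ U, F ((U : Matrix.specialUnitaryGroup (Fin 3) ℂ) : Matrix (Fin 3) (Fin 3) ℂ)
        ∂(haarProbability (Matrix.specialUnitaryGroup (Fin 3) ℂ))
      = 1 / (6 * (2 * π) ^ 2) * ∫ θ₁ in (0 : ℝ)..2 * π, ∫ θ₂ in (0 : ℝ)..2 * π,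
          F (Matrix.diagonal ![Complex.exp ((θ₁ : ℂ) * Complex.I), Complex.exp ((θ₂ : ℂ) * Complex.I),
            Complex.exp (((-(θ₁ + θ₂) : ℝ) : ℂ) * Complex.I)]) * weylSU3 θ₁ θ₂ :=
  Scoring.integral_haar_su3_classFun_eq_integral2 weyl_su3 F hF hcl

/-- **Functions of `Re tr U` on `SU(3)` integrate over the eigen-angles** (unconditional): for continuous `g`,
`∫_{SU(3)} g(Re tr U) dU = (1/(6(2π)²)) ∫_0^{2π}∫_0^{2π} g(reTrSU3 θ₁ θ₂) |Δ|²(θ₁,θ₂) dθ₂ dθ₁`. -/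
theorem integral_haar_su3_traceFun_eq_integral2 (g : ℝ → ℝ) (hg : Continuous g) :
    ∫ U, g ((U : Matrix.specialUnitaryGroup (Fin 3) ℂ) : Matrix (Fin 3) (Fin 3) ℂ).trace.re
        ∂(haarProbability (Matrix.specialUnitaryGroup (Fin 3) ℂ))
      = 1 / (6 * (2 * π) ^ 2) * ∫ θ₁ in (0 : ℝ)..2 * π, ∫ θ₂ in (0 : ℝ)..2 * π,
          g (reTrSU3 θ₁ θ₂) * weylSU3 θ₁ θ₂ :=
  Scoring.integral_haar_su3_traceFun_eq_integral2 weyl_su3 g hg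

/-! ### 2. theory-2's `SU(3)` one-plaquette integral in Bessel form -/

/-- **theory-2's `z₁^{SU(3)}(β) = e^{−3β} Z₃(3β)/(6(2π)²)`** (unconditional; `Z₃` = GEN-6's Weyl-torus
one-plaquette partition function, dictionary `β_table = 3β`). -/
theorem z1_su3_eq_onePlaquetteZSU3 (β : ℝ) :
    Theory2.Lattice.z1 (fundamentalRep (Fin 3)) β
      = ENNReal.ofReal (Real.exp (-(3 * β)) / (6 * (2 * π) ^ 2) * onePlaquetteZSU3 (3 * β)) :=
  Scoring.z1_su3_eq_onePlaquetteZSU3 weyl_su3 β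

/-- **theory-2's `SU(3)` one-plaquette integral in Bessel–Toeplitz form** (unconditional):
`z₁(β) = ∫_{SU(3)} e^{−β(3 − Re tr U)} dU = e^{−3β} Σ_{q ∈ ℤ} det[I_{|q+i−j|}(β)]_{i,j<3}` (Bars–Green form). -/
theorem z1_su3_eq_tsum_det (β : ℝ) :
    Theory2.Lattice.z1 (fundamentalRep (Fin 3)) β
      = ENNReal.ofReal (Real.exp (-(3 * β)) * ∑' q : ℤ,
          (Matrix.of fun i j : Fin 3 => besselI (q + (i : ℕ) - (j : ℕ)).natAbs β).det) :=
  Scoring.z1_su3_eq_tsum_det weyl_su3 β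

/-- **`z₁^{SU(3)}(β)` as a real number** (unconditional): `z₁(β).toReal = e^{−3β} Σ_q det[I_{|q+i−j|}(β)]`. -/
theorem z1_su3_toReal (β : ℝ) :
    (z1 (fundamentalRep (Fin 3)) β).toReal
      = Real.exp (-(3 * β)) * ∑' q : ℤ,
          (Matrix.of fun i j : Fin 3 => besselI (q + (i : ℕ) - (j : ℕ)).natAbs β).det :=
  Scoring.z1_su3_toReal weyl_su3 β

/-! ### 3. The Haar one-plaquette law of `SU(3)`: expectation, plaquette, enclosure, variance, monotonicity -/

/-- **The Haar one-plaquette expectation of any continuous `f(Re tr U)` is GEN-6's Weyl-torus expectation**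
(unconditional): `∫ f(Re tr U) e^{−β(3 − Re tr U)} dU / ∫ e^{−β(3 − Re tr U)} dU = onePlaquetteExpectSU3 (3β) (f ∘ reTrSU3)`. -/
theorem haar_su3_expect_eq_onePlaquetteExpectSU3 (β : ℝ) (f : ℝ → ℝ) (hf : Continuous f) :
    (∫ U, f ((U : Matrix.specialUnitaryGroup (Fin 3) ℂ) : Matrix (Fin 3) (Fin 3) ℂ).trace.re
          * Real.exp (-(β * (3 - ((U : Matrix.specialUnitaryGroup (Fin 3) ℂ) : Matrix (Fin 3) (Fin 3) ℂ).trace.re)))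
        ∂(haarProbability (Matrix.specialUnitaryGroup (Fin 3) ℂ)))
      / (∫ U, Real.exp (-(β * (3 - ((U : Matrix.specialUnitaryGroup (Fin 3) ℂ) : Matrix (Fin 3) (Fin 3) ℂ).trace.re)))
        ∂(haarProbability (Matrix.specialUnitaryGroup (Fin 3) ℂ)))
      = onePlaquetteExpectSU3 (3 * β) (fun θ₁ θ₂ => f (reTrSU3 θ₁ θ₂)) :=
  Scoring.haar_su3_expect_eq_onePlaquetteExpectSU3 weyl_su3 β f hf

/-- **THE HAAR ONE-PLAQUETTE PLAQUETTE OF `SU(3)` IS ROW 5's ORACLE** (unconditional):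
`⟨(1/3) Re tr U_p⟩_β^{Haar} = onePlaquetteExpectSU3 (3β) plaqSU3`. -/
theorem haar_su3_plaquette_eq (β : ℝ) :
    (∫ U, ((U : Matrix.specialUnitaryGroup (Fin 3) ℂ) : Matrix (Fin 3) (Fin 3) ℂ).trace.re / 3
          * Real.exp (-(β * (3 - ((U : Matrix.specialUnitaryGroup (Fin 3) ℂ) : Matrix (Fin 3) (Fin 3) ℂ).trace.re)))
        ∂(haarProbability (Matrix.specialUnitaryGroup (Fin 3) ℂ)))
      / (∫ U, Real.exp (-(β * (3 - ((U : Matrix.specialUnitaryGroup (Fin 3) ℂ) : Matrix (Fin 3) (Fin 3) ℂ).trace.re)))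
        ∂(haarProbability (Matrix.specialUnitaryGroup (Fin 3) ℂ)))
      = onePlaquetteExpectSU3 (3 * β) plaqSU3 :=
  Scoring.haar_su3_plaquette_eq weyl_su3 β

/-- **THE S0-C ORACLE ON THE HAAR MEASURE, KERNEL-ENCLOSED** (unconditional): at theory-2 coupling `5/3`
(table `β = 5`, the S0-C `SU(3)` point), `0.353954436705 ≤ ⟨(1/3) Re tr U_p⟩^{Haar} ≤ 0.353954436706`. -/
theorem haar_su3_plaquette_encl_five_thirds :
    (353954436705 : ℝ) / 1000000000000 ≤
      (∫ U, ((U : Matrix.specialUnitaryGroup (Fin 3) ℂ) : Matrix (Fin 3) (Fin 3) ℂ).trace.re / 3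
          * Real.exp (-((5 / 3 : ℝ) * (3 - ((U : Matrix.specialUnitaryGroup (Fin 3) ℂ) :
              Matrix (Fin 3) (Fin 3) ℂ).trace.re)))
        ∂(haarProbability (Matrix.specialUnitaryGroup (Fin 3) ℂ)))
      / (∫ U, Real.exp (-((5 / 3 : ℝ) * (3 - ((U : Matrix.specialUnitaryGroup (Fin 3) ℂ) :
              Matrix (Fin 3) (Fin 3) ℂ).trace.re)))
        ∂(haarProbability (Matrix.specialUnitaryGroup (Fin 3) ℂ))) ∧
    (∫ U, ((U : Matrix.specialUnitaryGroup (Fin 3) ℂ) : Matrix (Fin 3) (Fin 3) ℂ).trace.re / 3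
          * Real.exp (-((5 / 3 : ℝ) * (3 - ((U : Matrix.specialUnitaryGroup (Fin 3) ℂ) :
              Matrix (Fin 3) (Fin 3) ℂ).trace.re)))
        ∂(haarProbability (Matrix.specialUnitaryGroup (Fin 3) ℂ)))
      / (∫ U, Real.exp (-((5 / 3 : ℝ) * (3 - ((U : Matrix.specialUnitaryGroup (Fin 3) ℂ) :
              Matrix (Fin 3) (Fin 3) ℂ).trace.re)))
        ∂(haarProbability (Matrix.specialUnitaryGroup (Fin 3) ℂ)))
      ≤ (353954436706 : ℝ) / 1000000000000 :=
  Scoring.haar_su3_plaquette_encl_five_thirds weyl_su3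

/-- **The Haar one-plaquette plaquette of `SU(3)` in Bessel–Toeplitz form** (unconditional):
`⟨(1/3) Re tr U_p⟩_β = Σ_qΣ_l (det M⁺_{q,l} + det M⁻_{q,l}) / (6 Σ_q det[I_{|q+i−j|}(β)])`. -/
theorem haar_su3_plaquette_eq_tsum_det (β : ℝ) :
    (∫ U, ((U : Matrix.specialUnitaryGroup (Fin 3) ℂ) : Matrix (Fin 3) (Fin 3) ℂ).trace.re / 3
          * Real.exp (-(β * (3 - ((U : Matrix.specialUnitaryGroup (Fin 3) ℂ) : Matrix (Fin 3) (Fin 3) ℂ).trace.re)))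
        ∂(haarProbability (Matrix.specialUnitaryGroup (Fin 3) ℂ)))
      / (∫ U, Real.exp (-(β * (3 - ((U : Matrix.specialUnitaryGroup (Fin 3) ℂ) : Matrix (Fin 3) (Fin 3) ℂ).trace.re)))
        ∂(haarProbability (Matrix.specialUnitaryGroup (Fin 3) ℂ)))
      = (∑' q : ℤ, ∑ l : Fin 3,
          ((Matrix.of fun i j : Fin 3 =>
              besselI (q + (i : ℕ) - (j : ℕ) + if j = l then 1 else 0).natAbs β).det
            + (Matrix.of fun i j : Fin 3 =>
              besselI (q + (i : ℕ) - (j : ℕ) - if j = l then 1 else 0).natAbs β).det))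
        / (6 * ∑' q : ℤ, (Matrix.of fun i j : Fin 3 =>
            besselI (q + (i : ℕ) - (j : ℕ)).natAbs β).det) :=
  Scoring.haar_su3_plaquette_eq_tsum_det weyl_su3 β

/-- **The Haar one-plaquette plaquette of `SU(3)` is non-decreasing in the coupling** (unconditional). -/
theorem haar_su3_plaquette_monotone :
    Monotone fun β : ℝ =>
      (∫ U, ((U : Matrix.specialUnitaryGroup (Fin 3) ℂ) : Matrix (Fin 3) (Fin 3) ℂ).trace.re / 3
          * Real.exp (-(β * (3 - ((U : Matrix.specialUnitaryGroup (Fin 3) ℂ) : Matrix (Fin 3) (Fin 3) ℂ).trace.re)))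
        ∂(haarProbability (Matrix.specialUnitaryGroup (Fin 3) ℂ)))
      / (∫ U, Real.exp (-(β * (3 - ((U : Matrix.specialUnitaryGroup (Fin 3) ℂ) : Matrix (Fin 3) (Fin 3) ℂ).trace.re)))
        ∂(haarProbability (Matrix.specialUnitaryGroup (Fin 3) ℂ))) :=
  Scoring.haar_su3_plaquette_monotone weyl_su3

/-- **The Haar second moment of the `SU(3)` plaquette** (unconditional):
`⟨((1/3) Re tr U_p)²⟩_β^{Haar} = onePlaquetteExpectSU3 (3β) plaq²`. -/
theorem haar_su3_plaqSq_eq (β : ℝ) :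
    (∫ U, (((U : Matrix.specialUnitaryGroup (Fin 3) ℂ) : Matrix (Fin 3) (Fin 3) ℂ).trace.re / 3
          * (((U : Matrix.specialUnitaryGroup (Fin 3) ℂ) : Matrix (Fin 3) (Fin 3) ℂ).trace.re / 3))
          * Real.exp (-(β * (3 - ((U : Matrix.specialUnitaryGroup (Fin 3) ℂ) : Matrix (Fin 3) (Fin 3) ℂ).trace.re)))
        ∂(haarProbability (Matrix.specialUnitaryGroup (Fin 3) ℂ)))
      / (∫ U, Real.exp (-(β * (3 - ((U : Matrix.specialUnitaryGroup (Fin 3) ℂ) :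
          Matrix (Fin 3) (Fin 3) ℂ).trace.re)))
        ∂(haarProbability (Matrix.specialUnitaryGroup (Fin 3) ℂ)))
      = onePlaquetteExpectSU3 (3 * β) (fun θ₁ θ₂ => plaqSU3 θ₁ θ₂ * plaqSU3 θ₁ θ₂) :=
  Scoring.haar_su3_plaqSq_eq weyl_su3 β

/-- **THE HAAR VARIANCE OF THE `SU(3)` PLAQUETTE AT THE S0-C POINT, KERNEL-ENCLOSED** (unconditional):
at theory-2 coupling `5/3`, `0.071934473027 ≤ ⟨plaq²⟩ − ⟨plaq⟩² ≤ 0.071934473030`. -/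
theorem haar_su3_variance_encl_five_thirds :
    (71934473027 : ℝ) / 1000000000000 ≤
      (∫ U, (((U : Matrix.specialUnitaryGroup (Fin 3) ℂ) : Matrix (Fin 3) (Fin 3) ℂ).trace.re / 3
            * (((U : Matrix.specialUnitaryGroup (Fin 3) ℂ) : Matrix (Fin 3) (Fin 3) ℂ).trace.re / 3))
            * Real.exp (-((5 / 3 : ℝ) * (3 - ((U : Matrix.specialUnitaryGroup (Fin 3) ℂ) :
                Matrix (Fin 3) (Fin 3) ℂ).trace.re)))
          ∂(haarProbability (Matrix.specialUnitaryGroup (Fin 3) ℂ)))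
        / (∫ U, Real.exp (-((5 / 3 : ℝ) * (3 - ((U : Matrix.specialUnitaryGroup (Fin 3) ℂ) :
                Matrix (Fin 3) (Fin 3) ℂ).trace.re)))
          ∂(haarProbability (Matrix.specialUnitaryGroup (Fin 3) ℂ)))
      - ((∫ U, ((U : Matrix.specialUnitaryGroup (Fin 3) ℂ) : Matrix (Fin 3) (Fin 3) ℂ).trace.re / 3
            * Real.exp (-((5 / 3 : ℝ) * (3 - ((U : Matrix.specialUnitaryGroup (Fin 3) ℂ) :
                Matrix (Fin 3) (Fin 3) ℂ).trace.re)))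
          ∂(haarProbability (Matrix.specialUnitaryGroup (Fin 3) ℂ)))
        / (∫ U, Real.exp (-((5 / 3 : ℝ) * (3 - ((U : Matrix.specialUnitaryGroup (Fin 3) ℂ) :
                Matrix (Fin 3) (Fin 3) ℂ).trace.re)))
          ∂(haarProbability (Matrix.specialUnitaryGroup (Fin 3) ℂ)))) ^ 2 ∧
    (∫ U, (((U : Matrix.specialUnitaryGroup (Fin 3) ℂ) : Matrix (Fin 3) (Fin 3) ℂ).trace.re / 3
            * (((U : Matrix.specialUnitaryGroup (Fin 3) ℂ) : Matrix (Fin 3) (Fin 3) ℂ).trace.re / 3))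
            * Real.exp (-((5 / 3 : ℝ) * (3 - ((U : Matrix.specialUnitaryGroup (Fin 3) ℂ) :
                Matrix (Fin 3) (Fin 3) ℂ).trace.re)))
          ∂(haarProbability (Matrix.specialUnitaryGroup (Fin 3) ℂ)))
        / (∫ U, Real.exp (-((5 / 3 : ℝ) * (3 - ((U : Matrix.specialUnitaryGroup (Fin 3) ℂ) :
                Matrix (Fin 3) (Fin 3) ℂ).trace.re)))
          ∂(haarProbability (Matrix.specialUnitaryGroup (Fin 3) ℂ)))
      - ((∫ U, ((U : Matrix.specialUnitaryGroup (Fin 3) ℂ) : Matrix (Fin 3) (Fin 3) ℂ).trace.re / 3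
            * Real.exp (-((5 / 3 : ℝ) * (3 - ((U : Matrix.specialUnitaryGroup (Fin 3) ℂ) :
                Matrix (Fin 3) (Fin 3) ℂ).trace.re)))
          ∂(haarProbability (Matrix.specialUnitaryGroup (Fin 3) ℂ)))
        / (∫ U, Real.exp (-((5 / 3 : ℝ) * (3 - ((U : Matrix.specialUnitaryGroup (Fin 3) ℂ) :
                Matrix (Fin 3) (Fin 3) ℂ).trace.re)))
          ∂(haarProbability (Matrix.specialUnitaryGroup (Fin 3) ℂ)))) ^ 2
      ≤ (71934473030 : ℝ) / 1000000000000 :=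
  Scoring.haar_su3_variance_encl_five_thirds weyl_su3

/-! ### 4. Haar moments of `Re tr U` on `SU(3)` and the norm of the fundamental character -/

/-- **`∫_{SU(3)} 1 dU = 1`** read through the eigen-angle formula (unconditional sanity check of the
normalisation `6(2π)²`). -/
theorem integral_haar_su3_one :
    ∫ U, (fun _ : ℝ => (1 : ℝ)) ((U : Matrix.specialUnitaryGroup (Fin 3) ℂ) :
        Matrix (Fin 3) (Fin 3) ℂ).trace.re
      ∂(haarProbability (Matrix.specialUnitaryGroup (Fin 3) ℂ)) = 1 :=
  Scoring.integral_haar_su3_one weyl_su3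

/-- **`∫_{SU(3)} Re tr U dU = 0`** (unconditional). -/
theorem integral_haar_su3_trace_re :
    ∫ U, ((U : Matrix.specialUnitaryGroup (Fin 3) ℂ) : Matrix (Fin 3) (Fin 3) ℂ).trace.re
        ∂(haarProbability (Matrix.specialUnitaryGroup (Fin 3) ℂ)) = 0 :=
  Scoring.integral_haar_su3_trace_re weyl_su3

/-- **`∫_{SU(3)} (Re tr U)² dU = 1/2`** (unconditional). -/
theorem integral_haar_su3_trace_re_sq :
    ∫ U, ((U : Matrix.specialUnitaryGroup (Fin 3) ℂ) : Matrix (Fin 3) (Fin 3) ℂ).trace.re ^ 2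
        ∂(haarProbability (Matrix.specialUnitaryGroup (Fin 3) ℂ)) = 1 / 2 :=
  Scoring.integral_haar_su3_trace_re_sq weyl_su3

/-- **`∫_{SU(3)} (Re tr U)³ dU = 1/4`** (unconditional). -/
theorem integral_haar_su3_trace_re_cube :
    ∫ U, ((U : Matrix.specialUnitaryGroup (Fin 3) ℂ) : Matrix (Fin 3) (Fin 3) ℂ).trace.re ^ 3
        ∂(haarProbability (Matrix.specialUnitaryGroup (Fin 3) ℂ)) = 1 / 4 :=
  Scoring.integral_haar_su3_trace_re_cube weyl_su3

/-- **All the Haar moments `∫_{SU(3)} (1 + Re tr U)^k dU = su3Moment k / 6`** (unconditional; `su3Moment` =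
GEN-6's exact rationals `Σ_v c_v T_k(a_v, b_v)`). -/
theorem integral_haar_su3_one_add_trace_re_pow (k : ℕ) :
    ∫ U, (1 + ((U : Matrix.specialUnitaryGroup (Fin 3) ℂ) : Matrix (Fin 3) (Fin 3) ℂ).trace.re) ^ k
        ∂(haarProbability (Matrix.specialUnitaryGroup (Fin 3) ℂ))
      = ((su3Moment k : ℚ) : ℝ) / 6 :=
  Scoring.integral_haar_su3_one_add_trace_re_pow weyl_su3 k

/-- **`∫_{SU(3)} |tr U|² dU = 1`** (unconditional): the fundamental character of `SU(3)` has Haar norm one. -/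
theorem integral_haar_su3_normSq_trace :
    ∫ U, Complex.normSq
        ((U : Matrix.specialUnitaryGroup (Fin 3) ℂ) : Matrix (Fin 3) (Fin 3) ℂ).trace
        ∂(haarProbability (Matrix.specialUnitaryGroup (Fin 3) ℂ)) = 1 :=
  Scoring.integral_haar_su3_normSq_trace weyl_su3

/-! ### 5. The free energy of 2-d `SU(3)` lattice Yang–Mills on the torus -/

/-- **THE 2-d `SU(3)` TORUS FREE ENERGY IN BESSEL FORM, UP TO ONE PLAQUETTE** (unconditional): for `β ≥ 0`,
`L ≥ 2`, with `F(β) = −3β + log Σ_q det[I_{|q+i−j|}(β)]`,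
`(L² − 1) F(β) − 6β ≤ log Z^{SU(3)}_{(ℤ/L)²}(β) ≤ (L² − 1) F(β)`. -/
theorem log_partitionFunction_su3_two_mem {L : ℕ} [NeZero L] (hL : 2 ≤ L) {β : ℝ} (hβ : 0 ≤ β) :
    ((L ^ 2 - 1 : ℕ) : ℝ) * (-(3 * β) + Real.log (∑' q : ℤ,
        (Matrix.of fun i j : Fin 3 => besselI (q + (i : ℕ) - (j : ℕ)).natAbs β).det)) - β * 6
        ≤ Real.log (partitionFunction (d := 2) (L := L) (fundamentalRep (Fin 3)) β).toReal ∧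
      Real.log (partitionFunction (d := 2) (L := L) (fundamentalRep (Fin 3)) β).toReal
        ≤ ((L ^ 2 - 1 : ℕ) : ℝ) * (-(3 * β) + Real.log (∑' q : ℤ,
          (Matrix.of fun i j : Fin 3 => besselI (q + (i : ℕ) - (j : ℕ)).natAbs β).det)) :=
  Scoring.log_partitionFunction_su3_two_mem weyl_su3 hL hβ

/-- **THE FREE ENERGY DENSITY OF 2-d `SU(3)` LATTICE YANG–MILLS ON THE TORUS** (unconditional): for `β ≥ 0`,
`log Z^{SU(3)}_{(ℤ/(L+2))²}(β) / (L+2)² → −3β + log Σ_{q ∈ ℤ} det[I_{|q+i−j|}(β)]_{i,j<3}` as `L → ∞`. -/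
theorem tendsto_log_partitionFunction_su3_two_div_sq {β : ℝ} (hβ : 0 ≤ β) :
    Tendsto (fun L : ℕ =>
        Real.log (partitionFunction (d := 2) (L := L + 2) (fundamentalRep (Fin 3)) β).toReal
          / ((((L + 2) ^ 2 : ℕ) : ℝ)))
      atTop (𝓝 (-(3 * β) + Real.log (∑' q : ℤ,
        (Matrix.of fun i j : Fin 3 => besselI (q + (i : ℕ) - (j : ℕ)).natAbs β).det))) :=
  Scoring.tendsto_log_partitionFunction_su3_two_div_sq weyl_su3 hβ

end Summit.Ventures.LatticeQCDFlow.Scoring.SU3Haar
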